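import Summits.QuantumFields.YangMills.Theorems.LuscherReductionTwistedTraceScalingVacGradKernel
import Literature.MathematicalPhysics.QuantumFieldTheory.TorusChartFlatCochains
import HarnessLib

/-!
# Discrete Poincaré ∕ Hodge lemma on `(ℤ/L)³` for the vacuum curl: `ker (covCurl 1) = constModes L ⊔ gaugeModes L`

HELPER for the Leg lane (crux `TwistedTraceScaling`, stmt-QuantumFields-20203; LEAD `ym-luscher-20007-p1` g19, HANDOFF-g19 step (4)(b)
«`ker H = Γ ⊕ const`»), handed to the pooled prover ym-ir-line-pool-p3 g17 by director-ym R502-ym; `--supports stmt-QuantumFields-20203 --as helper`.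
Theorems only; everything BY NAME from the tree.

THE STATEMENT (as typed by the lane ∕ the director, not re-typed): ★★ `ker_covCurl_one_le : LinearMap.ker (covCurl (1 : GaugeConfig 3 L SU2)) ≤
constModes L ⊔ gaugeModes L` — a colour-vector-valued 1-form on the `L³` torus killed by the vacuum curl `D_1 = d` (`covCurl_one`) is a linearised
gauge mode `vacGrad φ` plus a constant (translation-invariant) mode.  With the landed converse inclusions (`constModes_le_ker_covCurl_one`,
`gaugeModes_le_ker`): ★ `ker_covCurl_one_eq`, `stiffSpace_eq_orthogonal : stiffSpace L = (constModes L ⊔ gaugeModes L)ᗮ`, and the lane's coercivity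
read on the explicit complement: ★ `stiff_coercive_of_mem_orthogonal : q ⟂ (constModes ⊔ gaugeModes) → (2 − 2cos(2π/L))·‖q‖² ≤ ‖covCurl 1 q‖²` (`L ≥ 2`).

MECHANISM (dedup-first — no Fourier analysis, no Green's function): the tree holds the structure theorem for FLAT `1`-cochains on EVERY charted
torus, `TorusChart.exists_d₀_eq_iff : (∃ f, θ = d₀ f) ↔ IsFlat θ ∧ wind θ = 0` (`Literature/…/TorusChartFlatCochains.lean`: flat = gradient + seam
cochain of the winding vector), and the isotropic chart `TorusChart.pi 3 L` of `Site 3 L = Fin 3 → ZMod L` whose unit translations `Pi.single i 1`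
ARE `Site.shift` (`pi_gen`).  Colour by colour, the cochain `ω_a x i := w ((x, i), a)` of `w ∈ ker (covCurl 1)` is flat — `(pi 3 L).d₁ ω_a x i j` is
the `((x,(i,j)),a)` component of `latCurl L w` for `i < j` (`latCurl_apply`), minus it for `j < i` (`d₁_swap`), `0` for `i = j` (`d₁_self`); the
CONSTANT cochain `κ_a i := wind ω_a i ∕ L` is flat with the same winding vector (`lineSum` of a constant is `L • κ_a i`), so `ω_a − κ_a` is a
gradient `d₀ f_a` (characteristic zero: division by `L`), i.e. `w = vacGrad φ + c` with `φ x a := f_a x` and `c ((x,i),a) := κ_a i ∈ constModes`.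

HONEST FRAMING: finite-dimensional linear algebra on the `L³` torus (discrete de Rham `H¹((ℤ/L)³; ℝ³) = constants`), read off the tree's torus-chart
calculus; a helper for step (4) of the lane's (B-OD) chain; Leg 0∕6; femto rung R2b1 is a stub of a child of a CONDITIONAL route; not infinite volume,
not a gap, not Clay — the Yang–Mills mass gap is NOT proved by any of this.
References: B. Eckmann, Comment. Math. Helv. 17 (1945) 240–255; M. Lüscher, Nucl. Phys. B219 (1983) 233, §3.
-/

set_option autoImplicit false

noncomputable section

open scoped BigOperators InnerProductSpace RealInnerProductSpace
open Literature.MathematicalPhysics.QuantumFieldTheory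
open Literature.MathematicalPhysics.QuantumLattice

namespace Summit.QuantumFields.YangMills.Theorems.FemtoTransferGap

open TwoLattice TwoLattice.Stiff TwoLattice.Cov TwoLattice.Toron

variable {L : ℕ} [NeZero L]

/-! ## §1 The colour cochains of a link field and their flatness -/

/-- The real `1`-cochain of colour `a` of a link field: `ω_a x i = w ((x, i), a)`. [folklore] -/
theorem d₁_pi_colour_eq_latCurl (w : LinkSpace L) (a : Fin 3) (x : Site 3 L) (i j : Fin 3) (hij : i < j) :
    (TorusChart.pi 3 L).d₁ (fun y k => w ((y, k), a)) x i j = latCurl L w ((x, ⟨(i, j), hij⟩), a) := by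
  rw [TorusChart.d₁_apply, latCurl_apply]
  rfl

/-- **A zero mode of the vacuum curl has flat colour cochains**: `covCurl 1 w = 0 ⇒ (pi 3 L).d₁ ω_a = 0` for every colour `a`
(`covCurl_one : covCurl 1 = latCurl L`; antisymmetry of `d₁`). [cite: Luscher1983, §3] -/
theorem d₁_pi_colour_eq_zero {w : LinkSpace L} (hw : covCurl (1 : GaugeConfig 3 L SU2) w = 0) (a : Fin 3) :
    (TorusChart.pi 3 L).d₁ (fun y k => w ((y, k), a)) = 0 := by
  rw [covCurl_one] at hw
  funext x i j
  rcases lt_trichotomy i j with hij | rfl | hji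
  · rw [d₁_pi_colour_eq_latCurl w a x i j hij, hw]
    rfl
  · exact (TorusChart.pi 3 L).d₁_self _ x i
  · rw [TorusChart.d₁_swap, d₁_pi_colour_eq_latCurl w a x j i hji, hw]
    simp

/-! ## §2 Constant cochains: flat, with prescribed winding -/

/-- A cochain constant in the site variable is flat. [folklore] -/
theorem isFlat_const_pi (κ : Fin 3 → ℝ) : (TorusChart.pi 3 L).IsFlat (fun (_ : Site 3 L) (i : Fin 3) => κ i) := by
  intro x i j
  simp only [TorusChart.d₁_apply]
  ring

/-- The winding of a constant cochain along the `i`-th axis loop is `L · κ i`. [folklore] -/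
theorem wind_const_pi (κ : Fin 3 → ℝ) (i : Fin 3) : (TorusChart.pi 3 L).wind (fun (_ : Site 3 L) (j : Fin 3) => κ j) i = (L : ℝ) * κ i := by
  rw [TorusChart.wind_eq, TorusChart.lineSum, Finset.sum_const, Finset.card_range, TorusChart.pi_period, nsmul_eq_mul]

/-- **A flat real cochain on `(ℤ/L)³` is a gradient plus the constant cochain `wind θ ∕ L`** (characteristic zero form of «flat = gradient + seam»:
the constant cochain carries the same winding vector, so the difference has zero winding and is a gradient by `exists_d₀_eq_iff`). [folklore] -/
theorem exists_eq_d₀_add_const_of_isFlat {θ : Site 3 L → Fin 3 → ℝ} (hθ : (TorusChart.pi 3 L).IsFlat θ) :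
    ∃ f : Site 3 L → ℝ, θ = (TorusChart.pi 3 L).d₀ f + fun _ i => (TorusChart.pi 3 L).wind θ i / L := by
  set κ : Fin 3 → ℝ := fun i => (TorusChart.pi 3 L).wind θ i / L with hκ
  have hL : (L : ℝ) ≠ 0 := by exact_mod_cast (NeZero.ne L)
  have hflat : (TorusChart.pi 3 L).IsFlat (θ - fun _ i => κ i) := hθ.sub (isFlat_const_pi κ)
  have hwind : (TorusChart.pi 3 L).wind (θ - fun _ i => κ i) = 0 := by
    funext i
    rw [TorusChart.wind_sub, Pi.sub_apply, wind_const_pi, Pi.zero_apply, hκ]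
    field_simp
    ring
  obtain ⟨f, hf⟩ := ((TorusChart.pi 3 L).exists_d₀_eq_iff (θ - fun _ i => κ i)).2 ⟨hflat, hwind⟩
  exact ⟨f, by rw [← hf]; abel⟩

/-! ## §3 The Poincaré ∕ Hodge lemma for the vacuum curl -/

omit [NeZero L] in
/-- A link field whose value does not depend on the site is a constant mode. [folklore] -/
theorem constLink_mem_constModes (κ : Fin 3 → Fin 3 → ℝ) :
    (WithLp.toLp 2 fun ea : Edge 3 L × Fin 3 => κ ea.2 ea.1.2) ∈ constModes L := by
  intro y
  ext ⟨⟨x, i⟩, a⟩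
  rw [shiftLink_apply]

/-- ★★ **DISCRETE POINCARÉ ∕ HODGE LEMMA ON `(ℤ/L)³` FOR THE VACUUM CURL**: `ker (covCurl 1) ≤ constModes L ⊔ gaugeModes L` — every colour-vector-valued
link field killed by the vacuum curl is a linearised gauge mode plus a constant mode.  Proof: the tree's structure theorem for flat cochains on the
isotropic chart `TorusChart.pi 3 L`, colour by colour (`exists_eq_d₀_add_const_of_isFlat`). [cite: Luscher1983, §3] -/
theorem ker_covCurl_one_le : LinearMap.ker (covCurl (1 : GaugeConfig 3 L SU2)) ≤ constModes L ⊔ gaugeModes L := by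
  intro w hw
  rw [LinearMap.mem_ker] at hw
  -- colour by colour: a gradient plus a constant
  have hdec : ∀ a : Fin 3, ∃ f : Site 3 L → ℝ, (fun y k => w ((y, k), a)) =
      (TorusChart.pi 3 L).d₀ f + fun _ i => (TorusChart.pi 3 L).wind (fun y k => w ((y, k), a)) i / L :=
    fun a => exists_eq_d₀_add_const_of_isFlat (fun x i j => by rw [d₁_pi_colour_eq_zero hw a]; rfl)
  choose f hf using hdec
  set φ : Site 3 L → Fin 3 → ℝ := fun x a => f a x with hφ
  set κ : Fin 3 → Fin 3 → ℝ := fun a i => (TorusChart.pi 3 L).wind (fun y k => w ((y, k), a)) i / L with hκ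
  set c : LinkSpace L := WithLp.toLp 2 fun ea : Edge 3 L × Fin 3 => κ ea.2 ea.1.2 with hc
  have hsum : w = c + vacGrad L φ := by
    ext ⟨⟨x, i⟩, a⟩
    have h := congrFun (congrFun (hf a) x) i
    simp only [Pi.add_apply, TorusChart.d₀_apply, TorusChart.pi_gen] at h
    rw [PiLp.add_apply, vacGrad_apply]
    change w ((x, i), a) = (TorusChart.pi 3 L).wind (fun y k => w ((y, k), a)) i / L + (f a (x + Pi.single i 1) - f a x)
    linarith
  rw [hsum]
  exact Submodule.add_mem_sup (constLink_mem_constModes κ) (LinearMap.mem_range_self _ _)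

/-- ★ **`ker (covCurl 1) = constModes L ⊔ gaugeModes L`** (with the landed `constModes_le_ker_covCurl_one` and `gaugeModes_le_ker`). [cite: Luscher1983, §3] -/
theorem ker_covCurl_one_eq : LinearMap.ker (covCurl (1 : GaugeConfig 3 L SU2)) = constModes L ⊔ gaugeModes L :=
  le_antisymm ker_covCurl_one_le (sup_le constModes_le_ker_covCurl_one (gaugeModes_le_ker L))

/-- The stiff space is the orthogonal complement of `constModes ⊔ gaugeModes`. [cite: Luscher1983, §3] -/
theorem stiffSpace_eq_orthogonal : stiffSpace L = (constModes L ⊔ gaugeModes L)ᗮ := by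
  rw [stiffSpace, ker_covCurl_one_eq]

/-- ★ **Stiff coercivity on the explicit complement**: for `L ≥ 2` and `q ⟂ (constModes L ⊔ gaugeModes L)`,
`(2 − 2cos(2π/L))·‖q‖² ≤ ‖covCurl 1 q‖²` (the lane's `stiff_coercive`, read through `stiffSpace_eq_orthogonal`). [cite: Luscher1983, §3] -/
theorem stiff_coercive_of_mem_orthogonal (hL : 2 ≤ L) {q : LinkSpace L} (hq : q ∈ (constModes L ⊔ gaugeModes L)ᗮ) :
    (2 - 2 * Real.cos (2 * Real.pi / L)) * ‖q‖ ^ 2 ≤ ‖covCurl (1 : GaugeConfig 3 L SU2) q‖ ^ 2 :=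
  stiff_coercive hL (by rwa [stiffSpace_eq_orthogonal])

/-- A balanced (⟂ constants) link field orthogonal to the gauge modes is stiff: `q ⟂ constModes`, `q ⟂ gaugeModes` ⇒ `q ∈ stiffSpace L`. [folklore] -/
theorem mem_stiffSpace_of_orthogonal {q : LinkSpace L} (hc : q ∈ (constModes L)ᗮ) (hg : q ∈ (gaugeModes L)ᗮ) : q ∈ stiffSpace L := by
  rw [stiffSpace_eq_orthogonal, Submodule.mem_orthogonal]
  intro u hu
  obtain ⟨v, hv, g, hg', rfl⟩ := Submodule.mem_sup.1 hu
  rw [inner_add_left, Submodule.inner_right_of_mem_orthogonal hv hc, Submodule.inner_right_of_mem_orthogonal hg' hg, add_zero]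

end Summit.QuantumFields.YangMills.Theorems.FemtoTransferGap

end
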